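import Literature.NumberTheory.LFunctions.LiouvilleSumExpSqrtBound
import Literature.NumberTheory.LFunctions.SiegelWalfiszMoebius
import Literature.NumberTheory.LFunctions.PerronTruncated
import HarnessLib

/-!
# The Liouville function on integers coprime to `q`: `∑_{k ≤ N, (k,q)=1} λ(k) ≪ N (log x)^{-B}`

Topic `Literature/NumberTheory/LFunctions`. Everything in this file is PROVED.

The principal-character case of character sums of `λ`: since `λ` is COMPLETELY multiplicative,
Möbius inversion of the coprimality condition gives the exact identity

`∑_{k ≤ N, (k,q)=1} λ(k) = ∑_{d ∣ q} μ(d) λ(d) Λ₀(N/d)`, `Λ₀(z) = ∑_{k ≤ z} λ(k)`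

(`sum_liouville_coprime_eq`), and the prime number theorem for `λ`
(`abs_sum_liouville_le_mul_exp_neg_sqrt_log`, de la Vallée-Poussin error term) bounds each
`Λ₀(N/d)`; with `∑_{d ∣ q} 1/d ≤ 1 + log q` this yields (`abs_sum_liouville_coprime_le`): for
`B ≥ 0` there is `x₁` with `|∑_{k ≤ y, (k,q)=1} λ(k)| ≤ y/(log x)^B` for `x ≥ x₁`, `1 ≤ q ≤ x^{1/16}`,
`x^{1/2} ≤ y ≤ x²`.

## References

* [MontgomeryVaughan2007] H. L. Montgomery, R. C. Vaughan, *Multiplicative Number Theory I*,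
  CUP 2007, §6.2.1 Exercise 11 and §11.3 Exercise 8.
-/

open Finset ArithmeticFunction
open scoped ArithmeticFunction.Moebius

namespace Literature.NumberTheory.LFunctions

namespace LiouvilleCoprimeSum

/-- The multiples of `d ≥ 1` in `[1, y]` are the `dj`, `1 ≤ j ≤ y/d`. [folklore] -/
theorem filter_dvd_Icc_eq_image {d y : ℕ} (hd : 0 < d) :
    (Icc 1 y).filter (d ∣ ·) = (Icc 1 (y / d)).image (d * ·) := by
  ext k
  simp only [mem_filter, mem_Icc, mem_image]
  constructor
  · rintro ⟨⟨h1, h2⟩, ⟨j, rfl⟩⟩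
    refine ⟨j, ⟨?_, ?_⟩, rfl⟩
    · rcases Nat.eq_zero_or_pos j with h | h
      · subst h; simp at h1
      · exact h
    · exact (Nat.le_div_iff_mul_le hd).2 (by rw [mul_comm]; exact h2)
  · rintro ⟨j, ⟨h1, h2⟩, rfl⟩
    refine ⟨⟨Nat.mul_pos hd h1, ?_⟩, dvd_mul_right d j⟩
    have := (Nat.le_div_iff_mul_le hd).1 h2
    rw [mul_comm]; exact this

/-- `∑_{d ∣ g} μ(d) = [g = 1]` for `g ≥ 1` (Mathlib's `μ * ζ = 1`). [folklore] -/
theorem sum_divisors_moebius_eq (g : ℕ) :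
    ∑ d ∈ g.divisors, (μ d : ℝ) = if g = 1 then 1 else 0 := by
  have h := congrArg (fun f : ArithmeticFunction ℤ ↦ f g) moebius_mul_coe_zeta
  simp only [coe_mul_zeta_apply, one_apply] at h
  have h' := congrArg (fun z : ℤ ↦ (z : ℝ)) h
  push_cast at h'
  rw [h']

/-- **Möbius inversion of the coprimality condition for a completely multiplicative function**:
`∑_{k ≤ N, (k,q)=1} λ(k) = ∑_{d ∣ q} μ(d) λ(d) ∑_{m ≤ N/d} λ(m)` (`q ≥ 1`).
[cite: MontgomeryVaughan2007, §11.3 Exercise 8] -/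
theorem sum_liouville_coprime_eq {q : ℕ} (hq : 0 < q) (N : ℕ) :
    ∑ k ∈ (Icc 1 N).filter (fun k ↦ k.Coprime q), (liouville k : ℝ) =
      ∑ d ∈ q.divisors, (μ d : ℝ) * liouville d * ∑ m ∈ Icc 1 (N / d), (liouville m : ℝ) := by
  -- `[(k,q)=1] = ∑_{d ∣ q, d ∣ k} μ(d)`
  have hind : ∀ k : ℕ, (if k.Coprime q then (liouville k : ℝ) else 0) =
      ∑ d ∈ q.divisors, if d ∣ k then (μ d : ℝ) * liouville k else 0 := by
    intro k
    have h1 : ∑ d ∈ q.divisors, (if d ∣ k then (μ d : ℝ) * liouville k else 0) =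
        (∑ d ∈ (k.gcd q).divisors, (μ d : ℝ)) * liouville k := by
      rw [← sum_filter, sum_mul]
      refine sum_congr ?_ fun _ _ ↦ rfl
      ext d
      simp only [mem_filter, Nat.mem_divisors, Nat.dvd_gcd_iff]
      constructor
      · rintro ⟨⟨hdq, -⟩, hdk⟩
        exact ⟨⟨hdk, hdq⟩, Nat.gcd_ne_zero_right hq.ne'⟩
      · rintro ⟨⟨hdk, hdq⟩, -⟩
        exact ⟨⟨hdq, hq.ne'⟩, hdk⟩
    rw [h1, sum_divisors_moebius_eq]
    by_cases hk : k.Coprime q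
    · rw [if_pos hk, if_pos (Nat.coprime_iff_gcd_eq_one.1 hk), one_mul]
    · rw [if_neg hk, if_neg (fun h ↦ hk (Nat.coprime_iff_gcd_eq_one.2 h)), zero_mul]
  rw [sum_filter, sum_congr rfl fun k _ ↦ hind k, sum_comm]
  refine sum_congr rfl fun d hd ↦ ?_
  have hd0 : 0 < d := Nat.pos_of_mem_divisors hd
  rw [← sum_filter, filter_dvd_Icc_eq_image hd0, sum_image fun a _ b _ h ↦
    Nat.eq_of_mul_eq_mul_left hd0 h, mul_sum]
  refine sum_congr rfl fun m _ ↦ ?_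
  rw [liouville_apply_mul]; push_cast; ring

/-- The prime number theorem for `λ` in the `(log x)^{-B}` currency:
`|∑_{n ≤ x} λ(n)| ≤ C_B x/(log x)^B` for `x ≥ 2`. [cite: MontgomeryVaughan2007, §6.2.1 Exercise 11] -/
theorem exists_abs_sum_liouville_le_logPow (B : ℝ) :
    ∃ C : ℝ, 0 ≤ C ∧ ∀ x : ℝ, 2 ≤ x →
      |∑ n ∈ Ioc 0 ⌊x⌋₊, (liouville n : ℝ)| ≤ C * x / Real.log x ^ B := by
  obtain ⟨c, hc, C₁, hC₁⟩ := abs_sum_liouville_le_mul_exp_neg_sqrt_log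
  obtain ⟨C₂, hC₂0, hC₂⟩ := exists_mul_exp_neg_sqrt_log_le c hc B
  refine ⟨max C₁ 0 * C₂, by positivity, fun x hx ↦ ?_⟩
  have hx0 : 0 ≤ x := by linarith
  calc |∑ n ∈ Ioc 0 ⌊x⌋₊, (liouville n : ℝ)| ≤ C₁ * x * Real.exp (-c * Real.sqrt (Real.log x)) :=
        hC₁ x hx
    _ ≤ max C₁ 0 * (x * Real.exp (-c * Real.sqrt (Real.log x))) := by
        rw [mul_assoc]
        exact mul_le_mul_of_nonneg_right (le_max_left _ _) (by positivity)
    _ ≤ max C₁ 0 * (C₂ * x / Real.log x ^ B) :=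
        mul_le_mul_of_nonneg_left (hC₂ x hx) (le_max_right _ _)
    _ = max C₁ 0 * C₂ * x / Real.log x ^ B := by ring

/-- `∑_{d ∣ q} 1/d ≤ 1 + log q`. [folklore] -/
theorem sum_divisors_one_div_le (q : ℕ) : ∑ d ∈ q.divisors, (1 : ℝ) / d ≤ 1 + Real.log q := by
  calc ∑ d ∈ q.divisors, (1 : ℝ) / d ≤ ∑ d ∈ Finset.Ico 1 (q + 1), (1 : ℝ) / d := by
        refine sum_le_sum_of_subset_of_nonneg (fun d hd ↦ ?_) fun _ _ _ ↦ by positivity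
        rw [Finset.mem_Ico]
        exact ⟨Nat.pos_of_mem_divisors hd, Nat.lt_succ_of_le (Nat.divisor_le hd)⟩
    _ ≤ 1 + Real.log q := sum_Ico_one_div_le q

/-- **The principal-character case.** For `B ≥ 0` there is `x₁` such that for `x ≥ x₁`,
`1 ≤ q ≤ x^{1/16}` and `x^{1/2} ≤ y ≤ x²`: `|∑_{k ≤ y, (k,q)=1} λ(k)| ≤ y/(log x)^B`.
[cite: MontgomeryVaughan2007, §11.3 Exercise 8] -/
theorem abs_sum_liouville_coprime_le {B : ℝ} (hB : 0 ≤ B) :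
    ∃ x₁ : ℝ, ∀ x : ℝ, x₁ ≤ x → ∀ q : ℕ, 0 < q → (q : ℝ) ≤ x ^ (1 / 16 : ℝ) →
      ∀ y : ℝ, x ^ (1 / 2 : ℝ) ≤ y → y ≤ x ^ 2 →
        |∑ k ∈ (Icc 1 ⌊y⌋₊).filter (fun k ↦ k.Coprime q), (liouville k : ℝ)| ≤
          y / Real.log x ^ B := by
  obtain ⟨C, hC0, hC⟩ := exists_abs_sum_liouville_le_logPow (B + 2)
  refine ⟨Real.exp (max 80 (C * (5 / 2) ^ (B + 2))), fun x hx q hq hqx y hy1 hy2 ↦ ?_⟩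
  have hx0 : 0 < x := (Real.exp_pos _).trans_le hx
  set L := Real.log x with hL
  have hLge : max 80 (C * (5 / 2) ^ (B + 2)) ≤ L := by
    rw [hL, ← Real.log_exp (max _ _)]; exact Real.log_le_log (Real.exp_pos _) hx
  have hL30 : 80 ≤ L := (le_max_left _ _).trans hLge
  have hLC : C * (5 / 2) ^ (B + 2) ≤ L := (le_max_right _ _).trans hLge
  have hL0 : 0 < L := by linarith
  set N := ⌊y⌋₊ with hN
  have hy0 : 0 < y := (Real.rpow_pos_of_pos hx0 _).trans_le hy1
  have hNy : (N : ℝ) ≤ y := Nat.floor_le hy0.le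
  have hyN : y - 1 ≤ N := by have := Nat.lt_floor_add_one y; linarith
  -- each `N/d`, `d ∣ q`, is at least `x^{2/5}`
  have hq1 : (1 : ℝ) ≤ q := by exact_mod_cast hq
  have hx25 : ∀ d ∈ q.divisors, x ^ (2 / 5 : ℝ) ≤ ((N / d : ℕ) : ℝ) := by
    intro d hd
    have hd0 : 0 < d := Nat.pos_of_mem_divisors hd
    have hd0' : (0 : ℝ) < d := by exact_mod_cast hd0
    have hdq : (d : ℝ) ≤ x ^ (1 / 16 : ℝ) := le_trans (by exact_mod_cast Nat.divisor_le hd) hqx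
    -- `(N/d : ℕ) ≥ N/d − 1`
    have hdiv : (N : ℝ) / d - 1 ≤ ((N / d : ℕ) : ℝ) := by
      have h := Nat.lt_div_mul_add (a := N) hd0
      have h' : (N : ℝ) < ((N / d : ℕ) : ℝ) * d + d := by exact_mod_cast h
      rw [div_sub_one hd0'.ne', div_le_iff₀ hd0']; linarith
    refine le_trans ?_ hdiv
    rw [le_sub_iff_add_le, le_div_iff₀ hd0']
    -- `(x^{2/5} + 1) d ≤ 3 x^{2/5} x^{1/16} ≤ x^{1/2} − 1 ≤ N`
    have e1 : x ^ (2 / 5 : ℝ) = Real.exp (2 / 5 * L) := by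
      rw [Real.rpow_def_of_pos hx0, hL]; ring_nf
    have e2 : x ^ (1 / 16 : ℝ) = Real.exp (1 / 16 * L) := by
      rw [Real.rpow_def_of_pos hx0, hL]; ring_nf
    have e3 : x ^ (1 / 2 : ℝ) = Real.exp (1 / 2 * L) := by
      rw [Real.rpow_def_of_pos hx0, hL]; ring_nf
    have h1 : 1 ≤ Real.exp (2 / 5 * L) := Real.one_le_exp (by positivity)
    have h2 : 1 ≤ Real.exp (1 / 16 * L) := Real.one_le_exp (by positivity)
    have h3 : 3 * (Real.exp (2 / 5 * L) * Real.exp (1 / 16 * L)) + 1 ≤ Real.exp (1 / 2 * L) := by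
      have h4 : Real.exp (1 / 2 * L) = Real.exp (3 / 80 * L) *
          (Real.exp (2 / 5 * L) * Real.exp (1 / 16 * L)) := by
        rw [← Real.exp_add, ← Real.exp_add]; ring_nf
      have h5 : 4 ≤ Real.exp (3 / 80 * L) := by
        have := Real.add_one_le_exp (3 / 80 * L); linarith
      have hE : 1 ≤ Real.exp (2 / 5 * L) * Real.exp (1 / 16 * L) := one_le_mul_of_one_le_of_one_le h1 h2
      rw [h4]; nlinarith [mul_le_mul_of_nonneg_right h5 (zero_le_one.trans hE)]
    rw [e1]; rw [e2] at hdq; rw [e3] at hy1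
    nlinarith [mul_le_mul_of_nonneg_left hdq (Real.exp_pos (2 / 5 * L)).le, Real.exp_pos (2 / 5 * L)]
  -- the identity and the termwise bound
  rw [sum_liouville_coprime_eq hq]
  have hterm : ∀ d ∈ q.divisors, |(μ d : ℝ) * liouville d * ∑ m ∈ Icc 1 (N / d), (liouville m : ℝ)|
      ≤ C * (5 / 2) ^ (B + 2) / L ^ (B + 2) * N * (1 / d) := by
    intro d hd
    have hd0 : 0 < d := Nat.pos_of_mem_divisors hd
    have hd0' : (0 : ℝ) < d := by exact_mod_cast hd0
    set z : ℝ := ((N / d : ℕ) : ℝ) with hz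
    have hz25 := hx25 d hd
    have hx25' : Real.exp (2 / 5 * L) = x ^ (2 / 5 : ℝ) := by
      rw [Real.rpow_def_of_pos hx0, hL]; ring_nf
    have h12 : (12 : ℝ) ≤ 2 / 5 * L := by linarith
    have hz2 : 2 ≤ z := by
      have : (2 : ℝ) ≤ Real.exp (2 / 5 * L) := by
        have := Real.add_one_le_exp (2 / 5 * L); linarith
      rw [hx25'] at this; exact this.trans hz25
    have hz0 : 0 < z := by linarith
    have hlogz : 2 / 5 * L ≤ Real.log z := by
      have := Real.log_le_log (Real.rpow_pos_of_pos hx0 _) hz25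
      rwa [Real.log_rpow hx0, ← hL] at this
    have hPNT := hC z hz2
    rw [hz, Nat.floor_natCast, ← hz] at hPNT
    have hIoc : Ioc 0 (N / d) = Icc 1 (N / d) := rfl
    rw [hIoc] at hPNT
    have hml : |(μ d : ℝ) * liouville d| ≤ 1 := by
      rw [abs_mul]
      have hm : |(μ d : ℝ)| ≤ 1 := by exact_mod_cast abs_moebius_le_one
      calc |(μ d : ℝ)| * |(liouville d : ℝ)| ≤ 1 * 1 :=
            mul_le_mul hm (LiouvilleSum.abs_liouville_le_one d) (abs_nonneg _) zero_le_one
        _ = 1 := one_mul _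
    have hzN : z ≤ N * (1 / d) := by rw [hz, mul_one_div]; exact Nat.cast_div_le
    have hlogpow : (2 / 5 * L) ^ (B + 2) ≤ Real.log z ^ (B + 2) :=
      Real.rpow_le_rpow (by positivity) hlogz (by linarith)
    have hpow0 : 0 < (2 / 5 * L) ^ (B + 2) := Real.rpow_pos_of_pos (by positivity) _
    have e25 : (2 / 5 * L) ^ (B + 2) = L ^ (B + 2) / (5 / 2) ^ (B + 2) := by
      rw [Real.mul_rpow (by norm_num) hL0.le, show (2 / 5 : ℝ) = (5 / 2)⁻¹ by norm_num,
        Real.inv_rpow (by norm_num)]; ring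
    rw [abs_mul]
    calc |(μ d : ℝ) * liouville d| * |∑ m ∈ Icc 1 (N / d), (liouville m : ℝ)|
        ≤ 1 * (C * z / Real.log z ^ (B + 2)) := mul_le_mul hml hPNT (abs_nonneg _) zero_le_one
      _ ≤ C * (N * (1 / d)) / (2 / 5 * L) ^ (B + 2) := by
          rw [one_mul]; exact div_le_div₀ (by positivity) (by gcongr) hpow0 hlogpow
      _ = C * (5 / 2) ^ (B + 2) / L ^ (B + 2) * N * (1 / d) := by rw [e25]; field_simp
  have hsum1 := sum_divisors_one_div_le q
  have hlogq : Real.log q ≤ L / 16 := by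
    calc Real.log q ≤ Real.log (x ^ (1 / 16 : ℝ)) := Real.log_le_log (by positivity) hqx
      _ = L / 16 := by rw [Real.log_rpow hx0, ← hL]; ring
  have hK0 : 0 ≤ C * (5 / 2) ^ (B + 2) / L ^ (B + 2) * N := by positivity
  calc |∑ d ∈ q.divisors, (μ d : ℝ) * liouville d * ∑ m ∈ Icc 1 (N / d), (liouville m : ℝ)|
      ≤ ∑ d ∈ q.divisors, |(μ d : ℝ) * liouville d * ∑ m ∈ Icc 1 (N / d), (liouville m : ℝ)| :=
        abs_sum_le_sum_abs _ _
    _ ≤ ∑ d ∈ q.divisors, C * (5 / 2) ^ (B + 2) / L ^ (B + 2) * N * (1 / d) := sum_le_sum hterm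
    _ = C * (5 / 2) ^ (B + 2) / L ^ (B + 2) * N * ∑ d ∈ q.divisors, (1 : ℝ) / d := by
        rw [mul_sum]
    _ ≤ C * (5 / 2) ^ (B + 2) / L ^ (B + 2) * N * L :=
        mul_le_mul_of_nonneg_left (hsum1.trans (by linarith)) hK0
    _ ≤ y / L ^ B := by
        have hLB2 : L ^ (B + 2) = L ^ B * L ^ 2 := by
          rw [Real.rpow_add hL0, Real.rpow_two]
        have hLB0 : 0 < L ^ B := Real.rpow_pos_of_pos hL0 _
        rw [hLB2, le_div_iff₀ hLB0]
        have e : C * (5 / 2) ^ (B + 2) / (L ^ B * L ^ 2) * N * L * L ^ B =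
            C * (5 / 2) ^ (B + 2) / L * N := by field_simp
        rw [e, div_mul_eq_mul_div, div_le_iff₀ hL0]
        have hN0 : (0 : ℝ) ≤ N := Nat.cast_nonneg N
        nlinarith [mul_le_mul_of_nonneg_right hLC hN0]

end LiouvilleCoprimeSum

end Literature.NumberTheory.LFunctions
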